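import Literature.NumberTheory.Sieve.QuadraticRootsLevelAxisParam
import Literature.NumberTheory.Sieve.QuadraticRootsLevelOrbits
import Mathlib.GroupTheory.Archimedean
import Mathlib.Analysis.SpecialFunctions.Log.Basic
import HarnessLib

/-!
# Transport of geodesics under `SL₂(ℤ)` and the deck group of a closed geodesic (`Δ > 0`)

Topic `Literature/NumberTheory/Sieve`, continuation of the arithmetic–geometric trunk for
Á. Tóth's positive-discriminant equidistribution theorem (`QuadraticRootsLevelForms.lean`, …,
`QuadraticRootsLevelOrbitalWeight.lean`).  The *unfolding* of a sum of geodesic weights over the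
`T`-reduced forms of a `Γ₀(q)`-class into a cycle integral of a Poincaré series rests on two
geometric facts proved here:

* **transport**: for `g ∈ SL₂(ℤ)` the labelled roots move by `g⁻¹` (`rootPlus_smul`,
  `rootMinus_smul`), so that in the Cayley coordinates **`c_R(g • z) = κ(R, g) · c_{R·g}(z)`**
  (`cayley_smul_pt`) with a real constant `κ(R, g) = (a − cθ₊)/(a − cθ₋)` (`deckFactor`); hence
  `g` carries the parametrised geodesic of `R·g` onto that of `R` up to a dilation of the
  parameter (`smul_axisPt_smul`, and `smul_axisPt_negForm_smul` for the forms of the class with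
  `A < 0`, whose geodesics are parametrised through the opposite form `negForm Q = [−A, −B, −C]`
  and are traversed backwards);
* **the deck group**: on `stab R` the factor `κ` is a homomorphism into `ℝ_{>0}`
  (`deckFactor_mul`, `deckFactor_pos`) with kernel `{±1}` (`eq_or_eq_neg_of_deckFactor_eq_one`)
  and values isolated from `1` (`deckFactor_isolated`: `κ ≥ 1 + √Δ/A` or `κ ≤ (1 + √Δ/A)⁻¹` for
  `g ≠ ±1`), so that for every level `q ≥ 1` the level stabiliser `stab_q(R) = stab R ⊓ Γ₀(q)`
  (infinite, of finite index in `stab R`) is `{±g₁^k : k ∈ ℤ}` for a **primitive hyperbolic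
  element** `g₁` contracting the axis parameter, `g₁ • P_R(t) = P_R(κ₁ t)`, `0 < κ₁ < 1`
  (`exists_deck_generator`) — the deck transformation group of the closed geodesic of `R` on
  `Γ₀(q)∖ℍ`, of length `log κ₁⁻¹`.

Everything here is proved (elementary algebra, and `AddSubgroup.cyclic_of_isolated_zero` for the
discrete subgroup `{log κ(g)}` of `ℝ`); nothing of Tóth's paper (cite-only in the store) is
vendored.

## References

* Á. Tóth, *Roots of quadratic congruences*, IMRN 2000, no. 14, 719–739 (positive discriminant:
  sums over closed geodesics of `Γ₀(q)∖ℍ`; cite-only, cf. [cite: Ngo2024, §1]).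
  [cite: Toth2000, main theorem]
* W. Duke, J. B. Friedlander, H. Iwaniec, Ann. of Math. (2) 141 (1995), §2 p. 427–428 (the
  negative-discriminant model: `π ∘ σ = σ ∘ π`, stability groups `Γ_z`).
  [cite: DukeFriedlanderIwaniec1995, §2 p. 427]
* P. Sarnak, *Class numbers of indefinite binary quadratic forms*, J. Number Theory 15 (1982),
  §1 (automorphs of an indefinite form = the infinite cyclic group of a primitive hyperbolic
  element, up to sign; classical, re-proved here from scratch). [folklore]
-/

noncomputable section

namespace Literature.NumberTheory.Sieve

open scoped MatrixGroups UpperHalfPlane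
open Literature.NumberTheory.QuadraticFields.Quadratic (BinQF)
open UpperHalfPlane

namespace RootForms

variable {R : BinQF}

/-! ### The opposite form `−Q` -/

/-- The opposite form `−Q = [−A, −B, −C]`: same zero set and geodesic, roots exchanged. [folklore] -/
def negForm (Q : BinQF) : BinQF := ⟨-Q.a, -Q.b, -Q.c⟩

/-- Coefficients of `−Q`. [folklore] -/
@[simp] theorem negForm_a (Q : BinQF) : (negForm Q).a = -Q.a := rfl

/-- Coefficients of `−Q`. [folklore] -/
@[simp] theorem negForm_b (Q : BinQF) : (negForm Q).b = -Q.b := rfl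

/-- Coefficients of `−Q`. [folklore] -/
@[simp] theorem negForm_c (Q : BinQF) : (negForm Q).c = -Q.c := rfl

/-- `−(−Q) = Q`. [folklore] -/
@[simp] theorem negForm_negForm (Q : BinQF) : negForm (negForm Q) = Q := by
  ext <;> simp [negForm]

/-- `−Q` has the same discriminant. [folklore] -/
@[simp] theorem negForm_disc (Q : BinQF) : (negForm Q).disc = Q.disc := by
  simp only [BinQF.disc, negForm]; ring

/-- `√Δ(−Q) = √Δ(Q)`. [folklore] -/
@[simp] theorem sqrtDisc_negForm (Q : BinQF) : sqrtDisc (negForm Q) = sqrtDisc Q := by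
  rw [sqrtDisc, sqrtDisc, negForm_disc]

/-- The roots are exchanged: `θ₊(−Q) = θ₋(Q)`. [folklore] -/
theorem rootPlus_negForm (Q : BinQF) : rootPlus (negForm Q) = rootMinus Q := by
  rw [rootPlus, rootMinus, sqrtDisc_negForm, negForm_a, negForm_b]
  push_cast
  rw [neg_neg, ← neg_div_neg_eq]
  ring_nf

/-- The roots are exchanged: `θ₋(−Q) = θ₊(Q)`. [folklore] -/
theorem rootMinus_negForm (Q : BinQF) : rootMinus (negForm Q) = rootPlus Q := by
  have h := rootPlus_negForm (negForm Q)
  rw [negForm_negForm] at h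
  exact h.symm

/-- The Cayley coordinate of `−Q` is the inverse: `c_{−Q}(z) = c_Q(z)⁻¹`. [folklore] -/
theorem cayley_negForm (Q : BinQF) (z : ℂ) : cayley (negForm Q) z = (cayley Q z)⁻¹ := by
  rw [cayley, cayley, rootPlus_negForm, rootMinus_negForm, inv_div]

/-- `(−Q)·g = −(Q·g)` (the action is linear in the form). [folklore] -/
theorem smul_negForm (Q : BinQF) (g : SL(2, ℤ)) : smul (negForm Q) g = negForm (smul Q g) := by
  simp only [smul, BinQF.act, negForm]
  ext <;> dsimp <;> ring

/-- `herm (−Q) z = −herm Q z`. [folklore] -/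
theorem herm_negForm (Q : BinQF) (z : ℂ) : herm (negForm Q) z = -herm Q z := by
  simp only [herm, negForm]; push_cast; ring

/-- **`−Q` has the same geodesic.** [folklore] -/
@[simp] theorem geod_negForm (Q : BinQF) : geod (negForm Q) = geod Q := by
  ext z; rw [mem_geod, mem_geod, herm_negForm, neg_eq_zero]

/-- `(−Q).a > 0 ↔ Q.a < 0`. [folklore] -/
theorem negForm_a_pos {Q : BinQF} : 0 < (negForm Q).a ↔ Q.a < 0 := by
  rw [negForm_a, neg_pos]

/-- `−Q` has the same stabiliser. [folklore] -/
theorem mem_stab_negForm_iff {Q : BinQF} {s : SL(2, ℤ)} : s ∈ stab (negForm Q) ↔ s ∈ stab Q := by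
  rw [mem_stab_iff, mem_stab_iff, smul_negForm]
  constructor
  · intro h
    have := congrArg negForm h
    rwa [negForm_negForm, negForm_negForm] at this
  · intro h; rw [h]

/-! ### Transport of the roots under `SL₂(ℤ)` -/

section transport

variable (R) in
/-- The first coefficient of `R·g` over `ℝ`: `A' = Aa² + Bac + Cc²`. [cite: Cox2013, §2.A] -/
theorem smul_a_cast (g : SL(2, ℤ)) :
    ((smul R g).a : ℝ) = R.a * (g 0 0 : ℝ) ^ 2 + R.b * (g 0 0 : ℝ) * (g 1 0) + R.c * (g 1 0 : ℝ) ^ 2 := by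
  rw [smul_a, BinQF.eval]; push_cast; ring

variable (R) in
/-- The middle coefficient of `R·g` over `ℝ`. [cite: Cox2013, §2.A] -/
theorem smul_b_cast (g : SL(2, ℤ)) :
    ((smul R g).b : ℝ) = 2 * R.a * (g 0 0 : ℝ) * (g 0 1) + R.b * ((g 0 0 : ℝ) * (g 1 1) + (g 0 1 : ℝ) * (g 1 0)) +
      2 * R.c * (g 1 0 : ℝ) * (g 1 1) := by
  rw [smul_b]; push_cast; ring

/-- `ad − bc = 1` over `ℝ`. [folklore] -/
theorem det_cast (g : SL(2, ℤ)) :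
    (g 0 0 : ℝ) * (g 1 1) - (g 0 1 : ℝ) * (g 1 0) = 1 := by
  have h := g.det_coe
  rw [Matrix.det_fin_two] at h
  exact_mod_cast h

/-- **`A' = A (a − cθ₊)(a − cθ₋)`**: the first coefficient of `R·g` factors through the roots
(Vieta). [folklore] -/
theorem smul_a_eq_mul_rootFactors (hA : R.a ≠ 0) (hΔ : 0 ≤ R.disc) (g : SL(2, ℤ)) :
    ((smul R g).a : ℝ) =
      R.a * (((g 0 0 : ℝ) - (g 1 0) * rootPlus R) * ((g 0 0 : ℝ) - (g 1 0) * rootMinus R)) := by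
  rw [smul_a_cast]
  have hs := a_mul_root_sum hA
  have hp := a_mul_root_prod hA hΔ
  linear_combination ((g 0 0 : ℝ) * (g 1 0)) * hs - ((g 1 0 : ℝ) ^ 2) * hp

/-- If `(R·g).a ≠ 0` then `a − cθ₊ ≠ 0`. [folklore] -/
theorem rootFactor_plus_ne_zero (hA : R.a ≠ 0) (hΔ : 0 ≤ R.disc) {g : SL(2, ℤ)}
    (hA' : (smul R g).a ≠ 0) : (g 0 0 : ℝ) - (g 1 0) * rootPlus R ≠ 0 := by
  intro h
  apply hA'
  have := smul_a_eq_mul_rootFactors hA hΔ g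
  rw [h, zero_mul, mul_zero] at this
  exact_mod_cast this

/-- If `(R·g).a ≠ 0` then `a − cθ₋ ≠ 0`. [folklore] -/
theorem rootFactor_minus_ne_zero (hA : R.a ≠ 0) (hΔ : 0 ≤ R.disc) {g : SL(2, ℤ)}
    (hA' : (smul R g).a ≠ 0) : (g 0 0 : ℝ) - (g 1 0) * rootMinus R ≠ 0 := by
  intro h
  apply hA'
  have := smul_a_eq_mul_rootFactors hA hΔ g
  rw [h, mul_zero, mul_zero] at this
  exact_mod_cast this

/-- `√Δ(R·g) = √Δ(R)`. [folklore] -/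
@[simp] theorem sqrtDisc_smul (R : BinQF) (g : SL(2, ℤ)) : sqrtDisc (smul R g) = sqrtDisc R := by
  rw [sqrtDisc, sqrtDisc, smul_disc]

/-- **The labelled roots move by `g⁻¹`** (cleared of denominators):
`(a − cθ₊) · θ₊(R·g) = dθ₊ − b` for `g = (a b; c d)`, i.e. `θ₊(R·g) = g⁻¹θ₊(R)`; the labelling
`θ₊ = (−B + √Δ)/(2A)` is `SL₂(ℤ)`-equivariant. [cite: Toth2000, main theorem (closed geodesics; cf. Ngo2024 §1)] -/
theorem rootFactor_mul_rootPlus_smul (hA : R.a ≠ 0) (hΔ : 0 ≤ R.disc) (g : SL(2, ℤ))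
    (hA' : (smul R g).a ≠ 0) :
    ((g 0 0 : ℝ) - (g 1 0) * rootPlus R) * rootPlus (smul R g) = (g 1 1 : ℝ) * rootPlus R - g 0 1 := by
  have h1 := two_mul_a_mul_rootPlus hA
  have h1' := two_mul_a_mul_rootPlus hA'
  have hs := sqrtDisc_sq' hΔ
  have hdet := det_cast g
  have hAc : (R.a : ℝ) ≠ 0 := by exact_mod_cast hA
  have hAc' : ((smul R g).a : ℝ) ≠ 0 := by exact_mod_cast hA'
  rw [sqrtDisc_smul, smul_a_cast, smul_b_cast] at h1'
  rw [smul_a_cast] at hAc'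
  -- after clearing `4AA'` the identity is polynomial modulo `2Aθ₊ = −B + √Δ`,
  -- `2A'θ₊' = −B' + √Δ`, `√Δ² = B² − 4AC` and `ad − bc = 1`
  apply mul_left_cancel₀ (mul_ne_zero (mul_ne_zero (four_ne_zero (α := ℝ)) hAc) hAc')
  linear_combination
    (-( (g 1 0 : ℝ) * (2 * (R.a * (g 0 0 : ℝ) ^ 2 + R.b * (g 0 0 : ℝ) * (g 1 0) +
        R.c * (g 1 0 : ℝ) ^ 2) * rootPlus (smul R g))) -
        2 * (R.a * (g 0 0 : ℝ) ^ 2 + R.b * (g 0 0 : ℝ) * (g 1 0) + R.c * (g 1 0 : ℝ) ^ 2) * (g 1 1 : ℝ)) * h1 +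
    (2 * R.a * (g 0 0 : ℝ) - (g 1 0 : ℝ) * (-(R.b : ℝ) + sqrtDisc R)) * h1' +
    ((g 1 0 : ℝ) * ((R.b : ℝ) ^ 2 - 4 * R.a * R.c) - (2 * R.a * (g 0 0 : ℝ) + R.b * (g 1 0 : ℝ)) * sqrtDisc R) *
        hdet -
    (g 1 0 : ℝ) * hs

/-- The same for `θ₋`: `(a − cθ₋) · θ₋(R·g) = dθ₋ − b`. [cite: Toth2000, main theorem (closed geodesics; cf. Ngo2024 §1)] -/
theorem rootFactor_mul_rootMinus_smul (hA : R.a ≠ 0) (hΔ : 0 ≤ R.disc) (g : SL(2, ℤ))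
    (hA' : (smul R g).a ≠ 0) :
    ((g 0 0 : ℝ) - (g 1 0) * rootMinus R) * rootMinus (smul R g) = (g 1 1 : ℝ) * rootMinus R - g 0 1 := by
  have h2 := two_mul_a_mul_rootMinus hA
  have h2' := two_mul_a_mul_rootMinus hA'
  have hs := sqrtDisc_sq' hΔ
  have hdet := det_cast g
  have hAc : (R.a : ℝ) ≠ 0 := by exact_mod_cast hA
  have hAc' : ((smul R g).a : ℝ) ≠ 0 := by exact_mod_cast hA'
  rw [sqrtDisc_smul, smul_a_cast, smul_b_cast] at h2'
  rw [smul_a_cast] at hAc'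
  apply mul_left_cancel₀ (mul_ne_zero (mul_ne_zero (four_ne_zero (α := ℝ)) hAc) hAc')
  linear_combination
    (-( (g 1 0 : ℝ) * (2 * (R.a * (g 0 0 : ℝ) ^ 2 + R.b * (g 0 0 : ℝ) * (g 1 0) +
        R.c * (g 1 0 : ℝ) ^ 2) * rootMinus (smul R g))) -
        2 * (R.a * (g 0 0 : ℝ) ^ 2 + R.b * (g 0 0 : ℝ) * (g 1 0) + R.c * (g 1 0 : ℝ) ^ 2) * (g 1 1 : ℝ)) * h2 +
    (2 * R.a * (g 0 0 : ℝ) - (g 1 0 : ℝ) * (-(R.b : ℝ) - sqrtDisc R)) * h2' +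
    ((g 1 0 : ℝ) * ((R.b : ℝ) ^ 2 - 4 * R.a * R.c) + (2 * R.a * (g 0 0 : ℝ) + R.b * (g 1 0 : ℝ)) * sqrtDisc R) *
        hdet -
    (g 1 0 : ℝ) * hs

/-- **`θ₊(R·g) = g⁻¹ θ₊(R) = (dθ₊ − b)/(a − cθ₊)`.** [cite: Toth2000, main theorem (closed geodesics; cf. Ngo2024 §1)] -/
theorem rootPlus_smul (hA : R.a ≠ 0) (hΔ : 0 ≤ R.disc) (g : SL(2, ℤ)) (hA' : (smul R g).a ≠ 0) :
    rootPlus (smul R g) =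
      ((g 1 1 : ℝ) * rootPlus R - g 0 1) / ((g 0 0 : ℝ) - (g 1 0) * rootPlus R) := by
  rw [eq_div_iff (rootFactor_plus_ne_zero hA hΔ hA'), mul_comm]
  exact rootFactor_mul_rootPlus_smul hA hΔ g hA'

/-- **`θ₋(R·g) = g⁻¹ θ₋(R) = (dθ₋ − b)/(a − cθ₋)`.** [cite: Toth2000, main theorem (closed geodesics; cf. Ngo2024 §1)] -/
theorem rootMinus_smul (hA : R.a ≠ 0) (hΔ : 0 ≤ R.disc) (g : SL(2, ℤ)) (hA' : (smul R g).a ≠ 0) :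
    rootMinus (smul R g) =
      ((g 1 1 : ℝ) * rootMinus R - g 0 1) / ((g 0 0 : ℝ) - (g 1 0) * rootMinus R) := by
  rw [eq_div_iff (rootFactor_minus_ne_zero hA hΔ hA'), mul_comm]
  exact rootFactor_mul_rootMinus_smul hA hΔ g hA'

end transport

/-! ### Transport of the Cayley coordinate -/

section cayley

/-- The **transport factor** `κ(R, g) = (a − cθ₊)/(a − cθ₋)` of `g = (a b; c d)`.
[cite: Toth2000, main theorem (closed geodesics; cf. Ngo2024 §1)] -/
def deckFactor (R : BinQF) (g : SL(2, ℤ)) : ℝ :=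
  ((g 0 0 : ℝ) - (g 1 0) * rootPlus R) / ((g 0 0 : ℝ) - (g 1 0) * rootMinus R)

/-- `κ(R, g) ≠ 0` when `(R·g).a ≠ 0`. [folklore] -/
theorem deckFactor_ne_zero (hA : R.a ≠ 0) (hΔ : 0 ≤ R.disc) {g : SL(2, ℤ)}
    (hA' : (smul R g).a ≠ 0) : deckFactor R g ≠ 0 :=
  div_ne_zero (rootFactor_plus_ne_zero hA hΔ hA') (rootFactor_minus_ne_zero hA hΔ hA')

/-- `κ(R, 1) = 1`. [folklore] -/
@[simp] theorem deckFactor_one (R : BinQF) : deckFactor R 1 = 1 := by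
  simp [deckFactor]

/-- `κ(R, −g) = κ(R, g)`. [folklore] -/
@[simp] theorem deckFactor_neg (R : BinQF) (g : SL(2, ℤ)) : deckFactor R (-g) = deckFactor R g := by
  simp only [deckFactor, Matrix.SpecialLinearGroup.coe_neg, Matrix.neg_apply, Int.cast_neg]
  rw [← neg_div_neg_eq]
  ring_nf

/-- The numerator factorisation `(az + b) − θ₊(cz + d) = (a − cθ₊)(z − θ₊(R·g))`. [folklore] -/
theorem moebius_num_sub_rootPlus_mul (hA : R.a ≠ 0) (hΔ : 0 ≤ R.disc) (g : SL(2, ℤ))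
    (hA' : (smul R g).a ≠ 0) (z : ℂ) :
    (((g 0 0 : ℤ) : ℂ) * z + ((g 0 1 : ℤ) : ℂ)) -
        (rootPlus R : ℂ) * (((g 1 0 : ℤ) : ℂ) * z + ((g 1 1 : ℤ) : ℂ)) =
      (((g 0 0 : ℝ) - (g 1 0) * rootPlus R : ℝ) : ℂ) * (z - (rootPlus (smul R g) : ℂ)) := by
  have h := rootFactor_mul_rootPlus_smul hA hΔ g hA'
  have hc : ((((g 0 0 : ℝ) - (g 1 0) * rootPlus R) * rootPlus (smul R g) : ℝ) : ℂ) =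
      (((g 1 1 : ℝ) * rootPlus R - g 0 1 : ℝ) : ℂ) := by rw [h]
  push_cast at hc ⊢
  linear_combination hc

/-- The denominator factorisation `(az + b) − θ₋(cz + d) = (a − cθ₋)(z − θ₋(R·g))`. [folklore] -/
theorem moebius_num_sub_rootMinus_mul (hA : R.a ≠ 0) (hΔ : 0 ≤ R.disc) (g : SL(2, ℤ))
    (hA' : (smul R g).a ≠ 0) (z : ℂ) :
    (((g 0 0 : ℤ) : ℂ) * z + ((g 0 1 : ℤ) : ℂ)) -
        (rootMinus R : ℂ) * (((g 1 0 : ℤ) : ℂ) * z + ((g 1 1 : ℤ) : ℂ)) =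
      (((g 0 0 : ℝ) - (g 1 0) * rootMinus R : ℝ) : ℂ) * (z - (rootMinus (smul R g) : ℂ)) := by
  have h := rootFactor_mul_rootMinus_smul hA hΔ g hA'
  have hc : ((((g 0 0 : ℝ) - (g 1 0) * rootMinus R) * rootMinus (smul R g) : ℝ) : ℂ) =
      (((g 1 1 : ℝ) * rootMinus R - g 0 1 : ℝ) : ℂ) := by rw [h]
  push_cast at hc ⊢
  linear_combination hc

/-- **Transport of the Cayley coordinate**: `c_R(g • z) = κ(R, g) · c_{R·g}(z)` for `z ∈ ℍ`,
`(R·g).a ≠ 0`. [cite: Toth2000, main theorem (closed geodesics; cf. Ngo2024 §1)] -/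
theorem cayley_smul_pt (hA : R.a ≠ 0) (hΔ : 0 < R.disc) (g : SL(2, ℤ)) (hA' : (smul R g).a ≠ 0)
    (z : ℍ) :
    cayley R ((g • z : ℍ) : ℂ) = (deckFactor R g : ℂ) * cayley (smul R g) z := by
  have hD := denomZ_ne_zero g z
  rw [coe_smul_eq]
  set N : ℂ := ((g 0 0 : ℤ) : ℂ) * z + ((g 0 1 : ℤ) : ℂ) with hN
  set D : ℂ := ((g 1 0 : ℤ) : ℂ) * z + ((g 1 1 : ℤ) : ℂ) with hDdef
  have hz : (z : ℂ).im ≠ 0 := by rw [UpperHalfPlane.coe_im]; exact z.im_pos.ne'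
  have hθm : (z : ℂ) - rootMinus (smul R g) ≠ 0 := sub_real_ne_zero hz _
  have hfm : ((((g 0 0 : ℝ) - (g 1 0) * rootMinus R : ℝ)) : ℂ) ≠ 0 := by
    exact_mod_cast rootFactor_minus_ne_zero hA hΔ.le hA'
  have hnum : N - (rootPlus R : ℂ) * D =
      (((g 0 0 : ℝ) - (g 1 0) * rootPlus R : ℝ) : ℂ) * (z - (rootPlus (smul R g) : ℂ)) :=
    moebius_num_sub_rootPlus_mul hA hΔ.le g hA' z
  have hden : N - (rootMinus R : ℂ) * D =
      (((g 0 0 : ℝ) - (g 1 0) * rootMinus R : ℝ) : ℂ) * (z - (rootMinus (smul R g) : ℂ)) :=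
    moebius_num_sub_rootMinus_mul hA hΔ.le g hA' z
  have hden0 : N - (rootMinus R : ℂ) * D ≠ 0 := by
    rw [hden]; exact mul_ne_zero hfm hθm
  rw [cayley, cayley]
  rw [show N / D - (rootPlus R : ℂ) = (N - (rootPlus R : ℂ) * D) / D by field_simp,
    show N / D - (rootMinus R : ℂ) = (N - (rootMinus R : ℂ) * D) / D by field_simp,
    div_div_div_cancel_right₀ hD, hnum, hden, mul_div_mul_comm, deckFactor]
  push_cast
  ring

/-- `c_Q(z) ≠ 0` on `ℍ` (`A ≠ 0`, `Δ > 0`). [folklore] -/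
theorem cayley_ne_zero {Q : BinQF} (hA : Q.a ≠ 0) (hΔ : 0 < Q.disc) (z : ℍ) : cayley Q z ≠ 0 := by
  intro h
  have him := congrArg Complex.im h
  rw [cayley_im, Complex.zero_im, div_eq_zero_iff] at him
  have hz : 0 < (z : ℂ).im := by rw [UpperHalfPlane.coe_im]; exact z.im_pos
  have hn : Complex.normSq ((z : ℂ) - rootMinus Q) ≠ 0 :=
    (Complex.normSq_pos.2 (sub_real_ne_zero hz.ne' _)).ne'
  rcases him with h0 | h0
  · rcases mul_eq_zero.1 h0 with h1 | h1
    · exact rootPlus_ne_rootMinus hA hΔ (sub_eq_zero.1 h1)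
    · exact hz.ne' h1
  · exact hn h0

/-- For `A < 0`, `Δ > 0` the Cayley coordinate maps `ℍ` into the lower half-plane. [folklore] -/
theorem cayley_im_neg {Q : BinQF} (hA : Q.a < 0) (hΔ : 0 < Q.disc) (z : ℍ) : (cayley Q z).im < 0 := by
  have hz : 0 < (z : ℂ).im := by rw [UpperHalfPlane.coe_im]; exact z.im_pos
  have hn : 0 < Complex.normSq ((z : ℂ) - rootMinus Q) :=
    Complex.normSq_pos.2 (sub_real_ne_zero hz.ne' _)
  rw [cayley_im, rootPlus_sub_rootMinus hA.ne]
  have hA' : (Q.a : ℝ) < 0 := by exact_mod_cast hA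
  have h1 : sqrtDisc Q / Q.a < 0 := div_neg_of_pos_of_neg (sqrtDisc_pos hΔ) hA'
  exact div_neg_of_neg_of_pos (mul_neg_of_neg_of_pos h1 hz) hn

/-- `κ(R, g) > 0` when `A > 0` and `(R·g).a > 0` (both Cayley maps preserve `ℍ`). [folklore] -/
theorem deckFactor_pos_of_smul_a_pos (hA : 0 < R.a) (hΔ : 0 < R.disc) {g : SL(2, ℤ)}
    (hA' : 0 < (smul R g).a) : 0 < deckFactor R g := by
  have h := congrArg Complex.im (cayley_smul_pt hA.ne' hΔ g hA'.ne' UpperHalfPlane.I)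
  rw [Complex.im_ofReal_mul] at h
  have h1 := cayley_im_pos hA hΔ (g • UpperHalfPlane.I)
  have h2 := cayley_im_pos hA' (by rw [smul_disc]; exact hΔ) UpperHalfPlane.I
  rw [h] at h1
  exact (mul_pos_iff_of_pos_right h2).1 h1

/-- `κ(R, g) < 0` when `A > 0` and `(R·g).a < 0`. [folklore] -/
theorem deckFactor_neg_of_smul_a_neg (hA : 0 < R.a) (hΔ : 0 < R.disc) {g : SL(2, ℤ)}
    (hA' : (smul R g).a < 0) : deckFactor R g < 0 := by
  have h := congrArg Complex.im (cayley_smul_pt hA.ne' hΔ g hA'.ne UpperHalfPlane.I)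
  rw [Complex.im_ofReal_mul] at h
  have h1 := cayley_im_pos hA hΔ (g • UpperHalfPlane.I)
  have h2 := cayley_im_neg hA' (by rw [smul_disc]; exact hΔ) UpperHalfPlane.I
  rw [h] at h1
  by_contra hk
  push Not at hk
  have : deckFactor R g * (cayley (smul R g) UpperHalfPlane.I).im ≤ 0 :=
    mul_nonpos_of_nonneg_of_nonpos hk h2.le
  linarith

/-! ### Transport of the parametrised geodesic -/

/-- **`g • P_{R·g}(t) = P_R(κ t)`** for `(R·g).a > 0`: `g` maps the geodesic of `R·g` onto that of
`R` (`S_{R·g} = g⁻¹ S_R`), multiplying the parameter by `κ(R, g) > 0`.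
[cite: Toth2000, main theorem (closed geodesics; cf. Ngo2024 §1)] -/
theorem smul_axisPt_smul (hA : 0 < R.a) (hΔ : 0 < R.disc) (g : SL(2, ℤ))
    (hA' : 0 < (smul R g).a) (hΔ' : 0 < (smul R g).disc) {t : ℝ} (ht : 0 < t) :
    g • axisPt (smul R g) hA' hΔ' t ht =
      axisPt R hA hΔ (deckFactor R g * t) (mul_pos (deckFactor_pos_of_smul_a_pos hA hΔ hA') ht) := by
  apply cayley_injOn hA.ne' hΔ
  rw [cayley_smul_pt hA.ne' hΔ g hA'.ne', cayley_axisPt, cayley_axisPt]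
  push_cast
  ring

/-- **`g • P_{−(R·g)}(t) = P_R(|κ|/t)`** for `(R·g).a < 0`: the geodesic of `R·g` is that of the
opposite form `−(R·g)` (which has positive first coefficient), and `g` maps it onto `S_R`
reversing the orientation. [cite: Toth2000, main theorem (closed geodesics; cf. Ngo2024 §1)] -/
theorem smul_axisPt_negForm_smul (hA : 0 < R.a) (hΔ : 0 < R.disc) (g : SL(2, ℤ))
    (hA' : (smul R g).a < 0) (hA'' : 0 < (negForm (smul R g)).a)
    (hΔ'' : 0 < (negForm (smul R g)).disc) {t : ℝ} (ht : 0 < t) :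
    g • axisPt (negForm (smul R g)) hA'' hΔ'' t ht =
      axisPt R hA hΔ (-deckFactor R g / t)
        (div_pos (neg_pos.2 (deckFactor_neg_of_smul_a_neg hA hΔ hA')) ht) := by
  apply cayley_injOn hA.ne' hΔ
  have e : ∀ w : ℂ, cayley (smul R g) w = (cayley (negForm (smul R g)) w)⁻¹ := fun w => by
    rw [← cayley_negForm, negForm_negForm]
  rw [cayley_smul_pt hA.ne' hΔ g hA'.ne, e, coe_axisPt, cayley_axisPtC hA''.ne' hΔ'' ht,
    cayley_axisPt, mul_inv, Complex.inv_I]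
  have htC : (t : ℂ) ≠ 0 := by exact_mod_cast ht.ne'
  push_cast
  field_simp

end cayley

/-! ### The deck group: `κ` on `stab R` -/

section deck

/-- `(R·g).a = R.a` for `g ∈ stab R`. [folklore] -/
theorem smul_a_of_mem_stab {g : SL(2, ℤ)} (hg : g ∈ stab R) : (smul R g).a = R.a := by
  rw [mem_stab_iff.1 hg]

/-- **On the stabiliser, `c_R(g • z) = κ(g) c_R(z)`**: `stab R` acts on the axis by dilations.
[cite: Toth2000, main theorem (closed geodesics; cf. Ngo2024 §1)] -/
theorem cayley_smul_of_mem_stab (hA : R.a ≠ 0) (hΔ : 0 < R.disc) {g : SL(2, ℤ)} (hg : g ∈ stab R)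
    (z : ℍ) : cayley R ((g • z : ℍ) : ℂ) = (deckFactor R g : ℂ) * cayley R z := by
  have hA' : (smul R g).a ≠ 0 := by rwa [smul_a_of_mem_stab hg]
  rw [cayley_smul_pt hA hΔ g hA' z, mem_stab_iff.1 hg]

/-- For `g ∈ stab R`: `(a − cθ₊)(a − cθ₋) = 1` (the two factors are inverse units). [folklore] -/
theorem rootFactors_mul_eq_one (hA : R.a ≠ 0) (hΔ : 0 ≤ R.disc) {g : SL(2, ℤ)} (hg : g ∈ stab R) :
    ((g 0 0 : ℝ) - (g 1 0) * rootPlus R) * ((g 0 0 : ℝ) - (g 1 0) * rootMinus R) = 1 := by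
  have h := smul_a_eq_mul_rootFactors hA hΔ g
  rw [smul_a_of_mem_stab hg] at h
  have hAc : (R.a : ℝ) ≠ 0 := by exact_mod_cast hA
  have : (R.a : ℝ) * 1 = R.a * (((g 0 0 : ℝ) - (g 1 0) * rootPlus R) *
      ((g 0 0 : ℝ) - (g 1 0) * rootMinus R)) := by rw [mul_one]; exact h
  exact (mul_left_cancel₀ hAc this).symm

/-- For `g ∈ stab R`: **`κ(g) = (a − cθ₊)²`**. [folklore] -/
theorem deckFactor_eq_sq (hA : R.a ≠ 0) (hΔ : 0 ≤ R.disc) {g : SL(2, ℤ)} (hg : g ∈ stab R) :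
    deckFactor R g = ((g 0 0 : ℝ) - (g 1 0) * rootPlus R) ^ 2 := by
  have hA' : (smul R g).a ≠ 0 := by rwa [smul_a_of_mem_stab hg]
  rw [deckFactor, div_eq_iff (rootFactor_minus_ne_zero hA hΔ hA'), sq, mul_assoc,
    rootFactors_mul_eq_one hA hΔ hg, mul_one]

/-- **`κ(g) > 0` on `stab R`.** [folklore] -/
theorem deckFactor_pos (hA : R.a ≠ 0) (hΔ : 0 ≤ R.disc) {g : SL(2, ℤ)} (hg : g ∈ stab R) :
    0 < deckFactor R g := by
  have hA' : (smul R g).a ≠ 0 := by rwa [smul_a_of_mem_stab hg]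
  rw [deckFactor_eq_sq hA hΔ hg]
  exact lt_of_le_of_ne (sq_nonneg _) (Ne.symm (pow_ne_zero 2 (rootFactor_plus_ne_zero hA hΔ hA')))

/-- **`κ` is multiplicative on `stab R`.** [folklore] -/
theorem deckFactor_mul (hA : R.a ≠ 0) (hΔ : 0 < R.disc) {g h : SL(2, ℤ)} (hg : g ∈ stab R)
    (hh : h ∈ stab R) : deckFactor R (g * h) = deckFactor R g * deckFactor R h := by
  have e1 := cayley_smul_of_mem_stab hA hΔ (mul_mem hg hh) UpperHalfPlane.I
  rw [mul_smul, cayley_smul_of_mem_stab hA hΔ hg, cayley_smul_of_mem_stab hA hΔ hh,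
    ← mul_assoc] at e1
  have hc := cayley_ne_zero hA hΔ UpperHalfPlane.I
  have e2 := mul_right_cancel₀ hc e1
  exact_mod_cast e2.symm

/-- `κ(g⁻¹) = κ(g)⁻¹` on `stab R`. [folklore] -/
theorem deckFactor_inv (hA : R.a ≠ 0) (hΔ : 0 < R.disc) {g : SL(2, ℤ)} (hg : g ∈ stab R) :
    deckFactor R g⁻¹ = (deckFactor R g)⁻¹ := by
  have h := deckFactor_mul hA hΔ (inv_mem hg) hg
  rw [inv_mul_cancel, deckFactor_one] at h
  exact (eq_inv_of_mul_eq_one_left h.symm)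

/-- `κ(g^k) = κ(g)^k` on `stab R` (`k ∈ ℕ`). [folklore] -/
theorem deckFactor_pow (hA : R.a ≠ 0) (hΔ : 0 < R.disc) {g : SL(2, ℤ)} (hg : g ∈ stab R) (k : ℕ) :
    deckFactor R (g ^ k) = deckFactor R g ^ k := by
  induction k with
  | zero => simp
  | succ k ih => rw [pow_succ, deckFactor_mul hA hΔ (pow_mem hg k) hg, ih, pow_succ]

/-- `κ(g^k) = κ(g)^k` on `stab R` (`k ∈ ℤ`). [folklore] -/
theorem deckFactor_zpow (hA : R.a ≠ 0) (hΔ : 0 < R.disc) {g : SL(2, ℤ)} (hg : g ∈ stab R) (k : ℤ) :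
    deckFactor R (g ^ k) = deckFactor R g ^ k := by
  obtain ⟨n, rfl | rfl⟩ := Int.eq_nat_or_neg k
  · rw [zpow_natCast, zpow_natCast, deckFactor_pow hA hΔ hg]
  · rw [zpow_neg, zpow_neg, zpow_natCast, zpow_natCast, deckFactor_inv hA hΔ (pow_mem hg n),
      deckFactor_pow hA hΔ hg]

/-- **The stabiliser acts on the parametrised axis by `g • P_R(t) = P_R(κ(g) t)`.**
[cite: Toth2000, main theorem (closed geodesics; cf. Ngo2024 §1)] -/
theorem smul_axisPt_of_mem_stab (hA : 0 < R.a) (hΔ : 0 < R.disc) {g : SL(2, ℤ)} (hg : g ∈ stab R)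
    {t : ℝ} (ht : 0 < t) :
    g • axisPt R hA hΔ t ht =
      axisPt R hA hΔ (deckFactor R g * t) (mul_pos (deckFactor_pos hA.ne' hΔ.le hg) ht) := by
  apply cayley_injOn hA.ne' hΔ
  rw [cayley_smul_of_mem_stab hA.ne' hΔ hg, cayley_axisPt, cayley_axisPt]
  push_cast
  ring

/-! ### Kernel and discreteness of `κ` -/

/-- The point `2i ∈ ℍ`. [folklore] -/
def twoI : ℍ := ⟨2 * Complex.I, by simp⟩

/-- A matrix of `SL₂(ℤ)` with `b = c = 0`, `a = d = 1` is `1`. [folklore] -/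
theorem eq_one_of_entries {g : SL(2, ℤ)} (ha : g 0 0 = 1) (hb : g 0 1 = 0) (hc : g 1 0 = 0)
    (hd : g 1 1 = 1) : g = 1 := by
  ext i j
  fin_cases i <;> fin_cases j <;> simp [ha, hb, hc, hd]

/-- A matrix of `SL₂(ℤ)` with `b = c = 0`, `a = d = −1` is `−1`. [folklore] -/
theorem eq_neg_one_of_entries {g : SL(2, ℤ)} (ha : g 0 0 = -1) (hb : g 0 1 = 0) (hc : g 1 0 = 0)
    (hd : g 1 1 = -1) : g = -1 := by
  ext i j
  fin_cases i <;> fin_cases j <;> simp [ha, hb, hc, hd]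

/-- An element of `SL₂(ℤ)` acting trivially on `ℍ` is `±1`. [folklore] -/
theorem eq_one_or_eq_neg_one_of_forall_smul_eq {g : SL(2, ℤ)} (h : ∀ z : ℍ, g • z = z) :
    g = 1 ∨ g = -1 := by
  have key : ∀ z : ℍ, ((g 0 0 : ℤ) : ℂ) * z + ((g 0 1 : ℤ) : ℂ) =
      (((g 1 0 : ℤ) : ℂ) * z + ((g 1 1 : ℤ) : ℂ)) * z := by
    intro z
    have e : (((g • z : ℍ)) : ℂ) = (z : ℂ) := by rw [h z]
    rw [coe_smul_eq, div_eq_iff (denomZ_ne_zero g z)] at e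
    rw [e]; ring
  have e1 := key UpperHalfPlane.I
  have e2 := key twoI
  have htwo : ((twoI : ℍ) : ℂ) = 2 * Complex.I := rfl
  rw [UpperHalfPlane.coe_I] at e1
  rw [htwo] at e2
  -- `b + c + (a − d) i = 0` and `b + 4c + 2(a − d) i = 0`
  have f1 : (((g 0 1 : ℤ) : ℂ) + (g 1 0 : ℤ)) + (((g 0 0 : ℤ) : ℂ) - (g 1 1 : ℤ)) * Complex.I = 0 := by
    linear_combination e1 + ((g 1 0 : ℤ) : ℂ) * Complex.I_sq
  have f2 : (((g 0 1 : ℤ) : ℂ) + 4 * (g 1 0 : ℤ)) + (2 * (((g 0 0 : ℤ) : ℂ) - (g 1 1 : ℤ))) * Complex.I = 0 := by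
    linear_combination e2 + (4 * ((g 1 0 : ℤ) : ℂ)) * Complex.I_sq
  have r1 := congrArg Complex.re f1
  have i1 := congrArg Complex.im f1
  have r2 := congrArg Complex.re f2
  simp only [Complex.add_re, Complex.intCast_re, Complex.mul_re, Complex.sub_re, Complex.I_re,
    mul_zero, Complex.sub_im, Complex.intCast_im, sub_self, Complex.I_im, mul_one, sub_zero,
    add_zero, Complex.zero_re, Complex.add_im, Complex.mul_im, zero_add, Complex.zero_im,
    Complex.re_ofNat, Complex.im_ofNat, zero_mul] at r1 i1 r2
  have had : (g 0 0 : ℤ) - g 1 1 = 0 := by exact_mod_cast i1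
  have hcR : ((g 1 0 : ℤ) : ℝ) = 0 := by linarith
  have hbR : ((g 0 1 : ℤ) : ℝ) = 0 := by linarith
  have hc : g 1 0 = 0 := by exact_mod_cast hcR
  have hb : g 0 1 = 0 := by exact_mod_cast hbR
  have hdet : g 0 0 * g 1 1 - g 0 1 * g 1 0 = 1 := by
    have h' := g.det_coe; rwa [Matrix.det_fin_two] at h'
  rw [hb, hc, mul_zero, sub_zero] at hdet
  rcases Int.eq_one_or_neg_one_of_mul_eq_one' hdet with ⟨ha, hd⟩ | ⟨ha, hd⟩
  · exact Or.inl (eq_one_of_entries ha hb hc hd)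
  · exact Or.inr (eq_neg_one_of_entries ha hb hc hd)

/-- **The kernel of `κ` on `stab R` is `{±1}`.** [folklore] -/
theorem eq_or_eq_neg_of_deckFactor_eq_one (hA : R.a ≠ 0) (hΔ : 0 < R.disc) {g : SL(2, ℤ)}
    (hg : g ∈ stab R) (h1 : deckFactor R g = 1) : g = 1 ∨ g = -1 := by
  apply eq_one_or_eq_neg_one_of_forall_smul_eq
  intro z
  apply cayley_injOn hA hΔ
  rw [cayley_smul_of_mem_stab hA hΔ hg, h1]
  push_cast
  ring

/-- An element of `stab R` with lower-left entry `0` is `±1` (`A ≠ 0`): it is `±T^b` and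
`(R·T^b).b = B + 2Ab`. [folklore] -/
theorem eq_or_eq_neg_of_mem_stab_of_apply_10 (hA : R.a ≠ 0) {g : SL(2, ℤ)} (hg : g ∈ stab R)
    (hc : g 1 0 = 0) : g = 1 ∨ g = -1 := by
  have hdet : g 0 0 * g 1 1 - g 0 1 * g 1 0 = 1 := by
    have h' := g.det_coe; rwa [Matrix.det_fin_two] at h'
  rw [hc, mul_zero, sub_zero] at hdet
  have hbR : (smul R g).b = R.b := by rw [mem_stab_iff.1 hg]
  rw [smul_b, hc] at hbR
  -- `2 A a b + B (a d) = B` with `a d = 1`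
  have hab : 2 * R.a * g 0 0 * g 0 1 = 0 := by
    have : 2 * R.a * g 0 0 * g 0 1 + R.b * (g 0 0 * g 1 1 + g 0 1 * 0) + 2 * R.c * 0 * g 1 1 =
        2 * R.a * g 0 0 * g 0 1 + R.b := by rw [hdet]; ring
    linarith
  have ha0 : g 0 0 ≠ 0 := fun h0 => by rw [h0, zero_mul] at hdet; exact zero_ne_one hdet
  have hb : g 0 1 = 0 := by
    rcases mul_eq_zero.1 hab with h | h
    · rcases mul_eq_zero.1 h with h' | h'
      · exact absurd h' (mul_ne_zero two_ne_zero hA)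
      · exact absurd h' ha0
    · exact h
  rcases Int.eq_one_or_neg_one_of_mul_eq_one' hdet with ⟨ha, hd⟩ | ⟨ha, hd⟩
  · exact Or.inl (eq_one_of_entries ha hb hc hd)
  · exact Or.inr (eq_neg_one_of_entries ha hb hc hd)

/-- The gap constant `δ = √Δ/|A| > 0`. [folklore] -/
def deckGap (R : BinQF) : ℝ := sqrtDisc R / |(R.a : ℝ)|

/-- `δ > 0` for `Δ > 0`, `A ≠ 0`. [folklore] -/
theorem deckGap_pos (hA : R.a ≠ 0) (hΔ : 0 < R.disc) : 0 < deckGap R :=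
  div_pos (sqrtDisc_pos hΔ) (abs_pos.2 (by exact_mod_cast hA))

/-- **Isolation of `κ` from `1`**: for `g ∈ stab R`, `g ≠ ±1`, either `κ(g) ≥ 1 + δ` or
`κ(g) ≤ (1 + δ)⁻¹`, `δ = √Δ/|A|`.  (With `ε = a − cθ₊`, `ε' = a − cθ₋`: `εε' = 1` and
`|ε − ε'| = |c|√Δ/|A| ≥ δ` since `c ≠ 0`.) [folklore] -/
theorem deckFactor_isolated (hA : R.a ≠ 0) (hΔ : 0 < R.disc) {g : SL(2, ℤ)} (hg : g ∈ stab R)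
    (h1 : g ≠ 1) (h1' : g ≠ -1) :
    1 + deckGap R ≤ deckFactor R g ∨ deckFactor R g ≤ (1 + deckGap R)⁻¹ := by
  have hc : g 1 0 ≠ 0 := by
    intro hc
    rcases eq_or_eq_neg_of_mem_stab_of_apply_10 hA hg hc with h | h
    · exact h1 h
    · exact h1' h
  set ε : ℝ := (g 0 0 : ℝ) - (g 1 0) * rootPlus R with hε
  set ε' : ℝ := (g 0 0 : ℝ) - (g 1 0) * rootMinus R with hε'
  have hprod : ε * ε' = 1 := rootFactors_mul_eq_one hA hΔ.le hg
  have hκ : deckFactor R g = ε ^ 2 := deckFactor_eq_sq hA hΔ.le hg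
  have hδ := deckGap_pos hA hΔ
  set δ := deckGap R with hδdef
  -- `|ε − ε'| ≥ δ`
  have hdiff : δ ≤ |ε - ε'| := by
    have e : ε - ε' = -(g 1 0 : ℝ) * (sqrtDisc R / R.a) := by
      rw [hε, hε', ← rootPlus_sub_rootMinus hA]; ring
    rw [e, abs_mul, abs_neg, abs_div, hδdef, deckGap, abs_of_pos (sqrtDisc_pos hΔ)]
    have hc1 : (1 : ℝ) ≤ |((g 1 0 : ℤ) : ℝ)| := by
      rw [← Int.cast_abs]; exact_mod_cast Int.one_le_abs hc
    have hpos : 0 ≤ sqrtDisc R / |(R.a : ℝ)| := (deckGap_pos hA hΔ).le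
    calc sqrtDisc R / |(R.a : ℝ)| = 1 * (sqrtDisc R / |(R.a : ℝ)|) := (one_mul _).symm
      _ ≤ |((g 1 0 : ℤ) : ℝ)| * (sqrtDisc R / |(R.a : ℝ)|) :=
          mul_le_mul_of_nonneg_right hc1 hpos
  -- squares: `(ε − ε')² = ε² − 2 + ε'²` and `ε'² = 1/ε²`
  have hsq : δ ^ 2 ≤ (ε - ε') ^ 2 := by
    calc δ ^ 2 ≤ |ε - ε'| ^ 2 := pow_le_pow_left₀ hδ.le hdiff 2
      _ = (ε - ε') ^ 2 := sq_abs _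
  set x : ℝ := ε ^ 2 with hx
  have hx0 : 0 < x := by
    have hε0 : ε ≠ 0 := fun h0 => by rw [h0, zero_mul] at hprod; exact zero_ne_one hprod
    positivity
  -- `(x − 1)² ≥ δ² x`
  have hmain : δ ^ 2 * x ≤ (x - 1) ^ 2 := by
    have e : (x - 1) ^ 2 = (ε - ε') ^ 2 * x := by
      have : ε' = ε' * (ε * ε') := by rw [hprod, mul_one]
      rw [hx]
      nlinarith [hprod, this, sq_nonneg ε, sq_nonneg ε']
    rw [e]
    exact mul_le_mul_of_nonneg_right hsq hx0.le
  rw [hκ]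
  rcases le_or_gt 1 x with hx1 | hx1
  · -- `x ≥ 1`: `x ≥ 1 + δ`
    left
    by_contra hlt
    push Not at hlt
    -- `0 ≤ x − 1 < δ` gives `(x−1)² < δ² ≤ δ² x`
    have h01 : 0 ≤ x - 1 := by linarith
    have h02 : x - 1 < δ := by linarith
    have : (x - 1) ^ 2 < δ ^ 2 * x := by
      calc (x - 1) ^ 2 ≤ (x - 1) * δ := by nlinarith
        _ < δ * δ := by nlinarith
        _ = δ ^ 2 * 1 := by ring
        _ ≤ δ ^ 2 * x := by nlinarith
    linarith
  · -- `x < 1`: `x ≤ (1 + δ)⁻¹`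
    right
    rw [← one_div, le_div_iff₀ (by linarith : (0 : ℝ) < 1 + δ)]
    -- want `x (1 + δ) ≤ 1`, i.e. `δ x ≤ 1 − x`
    by_contra hlt
    push Not at hlt
    have h01 : 0 < 1 - x := by linarith
    have h02 : 1 - x < δ * x := by linarith
    -- `(1 − x)² < δ² x²  ≤ δ² x` would need `x ≤ 1`; we get `(1−x)² < δ x (1 − x) ... `
    have : (x - 1) ^ 2 < δ ^ 2 * x := by
      calc (x - 1) ^ 2 = (1 - x) * (1 - x) := by ring
        _ < (1 - x) * (δ * x) := by nlinarith
        _ < (δ * x) * (δ * x) := by nlinarith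
        _ = δ ^ 2 * x * x := by ring
        _ ≤ δ ^ 2 * x * 1 := by
            apply mul_le_mul_of_nonneg_left hx1.le; positivity
        _ = δ ^ 2 * x := by ring
    linarith

/-! ### The level stabiliser is infinite cyclic up to sign -/

variable {q : ℕ}

/-- `stab_q(R)` is infinite for non-square `Δ > 0` (finite index in the infinite `stab R`).
[cite: Toth2000, main theorem (closed geodesics; cf. Ngo2024 §1)] -/
theorem infinite_stabLevel (hΔ : 0 < R.disc) (hsq : ¬ IsSquare R.disc) (q : ℕ) [NeZero q] :
    (stabLevel R q : Set SL(2, ℤ)).Infinite := by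
  have hinf : Infinite (stab R) := infinite_stab_of_pos hΔ hsq
  have hidx := (relIndex_stabLevel_le R q).2
  intro hfin
  have hfinH : Finite (stabLevel R q) := hfin.to_subtype
  have hfinT : Finite ((stabLevel R q).subgroupOf (stab R)) :=
    Finite.of_equiv _ (Subgroup.subgroupOfEquivOfLe (stabLevel_le R q)).symm.toEquiv
  -- `|stab_q| · [stab : stab_q] = |stab| = 0` (infinite) with index `≠ 0` is absurd
  have hcard : Nat.card ((stabLevel R q).subgroupOf (stab R)) * (stabLevel R q).relIndex (stab R) =
      Nat.card (stab R) := Subgroup.card_mul_index _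
  have h0 : Nat.card (stab R) = 0 := Nat.card_eq_zero_of_infinite
  rw [h0] at hcard
  have h1 : Nat.card ((stabLevel R q).subgroupOf (stab R)) ≠ 0 := Nat.card_pos.ne'
  exact mul_ne_zero h1 hidx hcard

/-- There is an element of `stab_q(R)` other than `±1`. [folklore] -/
theorem exists_mem_stabLevel_ne (hΔ : 0 < R.disc) (hsq : ¬ IsSquare R.disc) (q : ℕ) [NeZero q] :
    ∃ g ∈ stabLevel R q, g ≠ 1 ∧ g ≠ -1 := by
  obtain ⟨g, hg, hno⟩ := (infinite_stabLevel hΔ hsq q).exists_notMem_finset {1, -1}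
  simp only [Finset.mem_insert, Finset.mem_singleton, not_or] at hno
  exact ⟨g, hg, hno.1, hno.2⟩

/-- The additive subgroup `Λ_q(R) = {log κ(g) : g ∈ stab_q(R)}` of `ℝ`. [folklore] -/
def logDeckSubgroup (R : BinQF) (hA : R.a ≠ 0) (hΔ : 0 < R.disc) (q : ℕ) : AddSubgroup ℝ where
  carrier := {x | ∃ g ∈ stabLevel R q, Real.log (deckFactor R g) = x}
  zero_mem' := ⟨1, one_mem _, by simp⟩
  add_mem' := by
    rintro _ _ ⟨g, hg, rfl⟩ ⟨h, hh, rfl⟩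
    refine ⟨g * h, mul_mem hg hh, ?_⟩
    rw [deckFactor_mul hA hΔ (stabLevel_le R q hg) (stabLevel_le R q hh),
      Real.log_mul (deckFactor_pos hA hΔ.le (stabLevel_le R q hg)).ne'
        (deckFactor_pos hA hΔ.le (stabLevel_le R q hh)).ne']
  neg_mem' := by
    rintro _ ⟨g, hg, rfl⟩
    refine ⟨g⁻¹, inv_mem hg, ?_⟩
    rw [deckFactor_inv hA hΔ (stabLevel_le R q hg), Real.log_inv]

/-- `Λ_q(R)` has `0` isolated: no `log κ(g)` in `(0, log(1 + δ))`. [folklore] -/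
theorem logDeckSubgroup_isolated (hA : R.a ≠ 0) (hΔ : 0 < R.disc) (q : ℕ) :
    Disjoint (logDeckSubgroup R hA hΔ q : Set ℝ) (Set.Ioo 0 (Real.log (1 + deckGap R))) := by
  rw [Set.disjoint_left]
  rintro _ ⟨g, hg, rfl⟩ ⟨h0, h1⟩
  have hgs := stabLevel_le R q hg
  have hκ := deckFactor_pos hA hΔ.le hgs
  have hδ := deckGap_pos hA hΔ
  have hne1 : g ≠ 1 := by rintro rfl; simp at h0
  have hne1' : g ≠ -1 := by rintro rfl; simp at h0
  rcases deckFactor_isolated hA hΔ hgs hne1 hne1' with h | h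
  · exact absurd (Real.log_le_log (by linarith) h) (not_le.2 h1)
  · have : Real.log (deckFactor R g) ≤ 0 := by
      apply Real.log_nonpos hκ.le
      calc deckFactor R g ≤ (1 + deckGap R)⁻¹ := h
        _ ≤ 1 := inv_le_one_of_one_le₀ (by linarith)
    linarith

/-- **The deck generator.**  For `A ≠ 0`, non-square `Δ > 0` and `q ≥ 1` there is
`g₁ ∈ stab_q(R)` with `0 < κ(g₁) < 1` such that every `g ∈ stab_q(R)` is `±g₁^k` for a (unique)
`k ∈ ℤ`: `stab_q(R) = {±1} × ⟨g₁⟩`, `g₁` a primitive hyperbolic element of `Γ₀(q)` fixing `θ±` —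
the deck group of the closed geodesic of `R` on `Γ₀(q)∖ℍ`.
[cite: Toth2000, main theorem (closed geodesics; cf. Ngo2024 §1)] -/
theorem exists_deck_generator (hA : R.a ≠ 0) (hΔ : 0 < R.disc) (hsq : ¬ IsSquare R.disc)
    (q : ℕ) [NeZero q] :
    ∃ g₁ ∈ stabLevel R q, deckFactor R g₁ < 1 ∧
      ∀ g ∈ stabLevel R q, ∃ k : ℤ, g = g₁ ^ k ∨ g = -g₁ ^ k := by
  have hδ := deckGap_pos hA hΔ
  obtain ⟨b, hb⟩ := AddSubgroup.cyclic_of_isolated_zero (Real.log_pos (by linarith))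
    (logDeckSubgroup_isolated hA hΔ q)
  -- `b ∈ Λ`, `b = log κ(g₀)`
  have hbΛ : b ∈ logDeckSubgroup R hA hΔ q := by
    rw [hb]; exact AddSubgroup.subset_closure rfl
  obtain ⟨g₀, hg₀, hg₀b⟩ := hbΛ
  -- every `log κ(g)` is an integer multiple of `b`
  have hmult : ∀ g ∈ stabLevel R q, ∃ n : ℤ, n • b = Real.log (deckFactor R g) := by
    intro g hg
    have : Real.log (deckFactor R g) ∈ logDeckSubgroup R hA hΔ q := ⟨g, hg, rfl⟩
    rw [hb, AddSubgroup.mem_closure_singleton] at this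
    exact this
  -- `b ≠ 0`
  have hb0 : b ≠ 0 := by
    intro hb0
    obtain ⟨g, hg, hne1, hne1'⟩ := exists_mem_stabLevel_ne hΔ hsq q
    obtain ⟨n, hn⟩ := hmult g hg
    rw [hb0, smul_zero] at hn
    have hκ1 : deckFactor R g = 1 :=
      Real.eq_one_of_pos_of_log_eq_zero (deckFactor_pos hA hΔ.le (stabLevel_le R q hg)) hn.symm
    rcases eq_or_eq_neg_of_deckFactor_eq_one hA hΔ (stabLevel_le R q hg) hκ1 with h | h
    · exact hne1 h
    · exact hne1' h
  -- the generator: `g₀` or `g₀⁻¹`, whichever contracts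
  have hg₀s := stabLevel_le R q hg₀
  have key : ∀ g₁ ∈ stabLevel R q, (Real.log (deckFactor R g₁) = b ∨ Real.log (deckFactor R g₁) = -b) →
      ∀ g ∈ stabLevel R q, ∃ k : ℤ, g = g₁ ^ k ∨ g = -g₁ ^ k := by
    intro g₁ hg₁ hlog g hg
    have hg₁s := stabLevel_le R q hg₁
    obtain ⟨n, hn⟩ := hmult g hg
    -- pick `k` with `log κ(g) = k log κ(g₁)`
    obtain ⟨k, hk⟩ : ∃ k : ℤ, Real.log (deckFactor R g) = k * Real.log (deckFactor R g₁) := by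
      rcases hlog with h | h
      · exact ⟨n, by rw [h, ← hn, zsmul_eq_mul]⟩
      · exact ⟨-n, by rw [h, ← hn, zsmul_eq_mul]; push_cast; ring⟩
    refine ⟨k, ?_⟩
    -- `κ(g g₁^{-k}) = 1`
    have hmem : g * (g₁ ^ k)⁻¹ ∈ stab R := mul_mem (stabLevel_le R q hg) (inv_mem (zpow_mem hg₁s k))
    have hκ : deckFactor R (g * (g₁ ^ k)⁻¹) = 1 := by
      rw [deckFactor_mul hA hΔ (stabLevel_le R q hg) (inv_mem (zpow_mem hg₁s k)),
        deckFactor_inv hA hΔ (zpow_mem hg₁s k), deckFactor_zpow hA hΔ hg₁s]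
      have hpos := deckFactor_pos hA hΔ.le (stabLevel_le R q hg)
      have hpos₁ := deckFactor_pos hA hΔ.le hg₁s
      have : deckFactor R g = deckFactor R g₁ ^ k := by
        apply Real.log_injOn_pos (Set.mem_Ioi.2 hpos) (Set.mem_Ioi.2 (zpow_pos hpos₁ k))
        rw [hk, Real.log_zpow]
      rw [this, mul_inv_cancel₀ (zpow_ne_zero k hpos₁.ne')]
    rcases eq_or_eq_neg_of_deckFactor_eq_one hA hΔ hmem hκ with h | h
    · left; rw [← mul_inv_eq_one, h]
    · right
      have : g = -1 * g₁ ^ k := by rw [← h]; group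
      rw [this, neg_one_mul]
  rcases lt_or_gt_of_ne hb0 with hneg | hpos
  · refine ⟨g₀, hg₀, ?_, key g₀ hg₀ (Or.inl hg₀b)⟩
    have := deckFactor_pos hA hΔ.le hg₀s
    rw [← hg₀b] at hneg
    exact (Real.log_neg_iff this).1 hneg
  · refine ⟨g₀⁻¹, inv_mem hg₀, ?_, key g₀⁻¹ (inv_mem hg₀) (Or.inr ?_)⟩
    · rw [deckFactor_inv hA hΔ hg₀s]
      have hκ := deckFactor_pos hA hΔ.le hg₀s
      rw [← hg₀b] at hpos
      have h1 : 1 < deckFactor R g₀ := (Real.log_pos_iff hκ.le).1 hpos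
      exact inv_lt_one_of_one_lt₀ h1
    · rw [deckFactor_inv hA hΔ hg₀s, Real.log_inv, hg₀b]

/-- Uniqueness of the exponent: `κ(g₁) ≠ 1` and `κ(±g₁^k) = κ(g₁)^k` determine `k`. [folklore] -/
theorem deck_zpow_injective (hA : R.a ≠ 0) (hΔ : 0 < R.disc) {g₁ : SL(2, ℤ)} (hg₁ : g₁ ∈ stab R)
    (hκ : deckFactor R g₁ < 1) {k k' : ℤ}
    (h : deckFactor R (g₁ ^ k) = deckFactor R (g₁ ^ k')) : k = k' := by
  rw [deckFactor_zpow hA hΔ hg₁, deckFactor_zpow hA hΔ hg₁] at h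
  have hpos := deckFactor_pos hA hΔ.le hg₁
  exact zpow_right_injective₀ hpos hκ.ne h

/-- `g₁^k ≠ −1` for the deck generator (indeed for any `g₁ ∈ stab R` with `κ(g₁) ≠ 1`). [folklore] -/
theorem deck_zpow_ne_neg_one (hA : R.a ≠ 0) (hΔ : 0 < R.disc) {g₁ : SL(2, ℤ)} (hg₁ : g₁ ∈ stab R)
    (hκ : deckFactor R g₁ < 1) (k : ℤ) : g₁ ^ k ≠ -1 := by
  intro h
  have h1 : deckFactor R (g₁ ^ k) = deckFactor R (g₁ ^ (0 : ℤ)) := by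
    rw [h, deckFactor_neg, zpow_zero]
  have hk := deck_zpow_injective hA hΔ hg₁ hκ h1
  rw [hk, zpow_zero] at h
  have := congrArg (fun g : SL(2, ℤ) => g 0 0) h
  simp at this

end deck

end RootForms

end Literature.NumberTheory.Sieve
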